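import Literature.Probability.LatticeModels.StarCrossing
import Literature.Probability.LatticeModels.ZhangCrossing
import Literature.Probability.LatticeModels.PlusMinusReflectionInvariance
import HarnessLib

/-!
# Zhang's crossing obstruction for a lattice path and a `∗`-path

Topic `Probability/LatticeModels` (planar lattice combinatorics of `ℤ²`); theorems only. The
`∗`-version of `ZhangCrossing.lean` needed when one colour is followed along nearest-neighbour
paths and the other along `∗`-paths (Georgii–Higuchi 2000, Cor. 3.3 and §§4–5: `+`clusters versus
`-∗`clusters): **in `Λ_N ⊆ ℤ²`, a lattice walk between the boundary arcs of two opposite closed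
quadrants and a `∗`-walk between the arcs of the other two quadrants have a common vertex**
(`exists_mem_support_of_quadrant_crossing_star`, lattice `∂₁ → ∂₃` versus `∗` `∂₂ → ∂₄`, and
`exists_mem_support_of_quadrant_crossing_star'`, `∗` `∂₁ → ∂₃` versus lattice `∂₂ → ∂₄`).

Proof of the first: the extensions of `ZhangCrossing` (`Zhang.exists_ext₁`–`₄`) turn the pair into
a left–right lattice crossing and a bottom–top `∗`-crossing of `Λ_{N+1}`, which meet by
`exists_mem_support_of_crossing_star`; the coordinate bookkeeping (`Zhang.eq_of_out_odd_even`,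
…) is reused. The second follows from the first applied to the images under the reflection
`x₀ ↦ -x₀`, an automorphism of both graphs exchanging `∂₁ ↔ ∂₂` and `∂₃ ↔ ∂₄`.

## References

* H.-O. Georgii, Y. Higuchi, J. Math. Phys. 41 (2000), §2 p. 4 and proof of Lemma 3.1, Step 2
  [GeorgiiHiguchi2000].
-/

noncomputable section

open SimpleGraph
open Literature.Probability.Percolation

namespace Literature.Probability.LatticeModels

open Zhang

/-- **Zhang's obstruction, lattice versus `∗`**: inside `Λ_N`, a lattice walk from `∂₁Λ_N` to
`∂₃Λ_N` and a `∗`-walk from `∂₂Λ_N` to `∂₄Λ_N` (closed-quadrant arcs) have a common vertex. [cite: GeorgiiHiguchi2000, Lemma 3.1 (proof, Step 2, p. 8)] -/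
theorem exists_mem_support_of_quadrant_crossing_star {N : ℕ} {e₁ e₂ e₃ e₄ : Site 2}
    (P : (zdGraph 2).Walk e₁ e₃) (Q : zdStarGraph.Walk e₂ e₄)
    (hP : ∀ z ∈ P.support, ∀ i, -(N : ℤ) ≤ z i ∧ z i ≤ N)
    (hQ : ∀ z ∈ Q.support, ∀ i, -(N : ℤ) ≤ z i ∧ z i ≤ N)
    (h₁ : (e₁ 0 = N ∧ 0 ≤ e₁ 1) ∨ (e₁ 1 = N ∧ 0 ≤ e₁ 0))
    (h₂ : (e₂ 1 = N ∧ e₂ 0 ≤ 0) ∨ (e₂ 0 = -N ∧ 0 ≤ e₂ 1))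
    (h₃ : (e₃ 0 = -N ∧ e₃ 1 ≤ 0) ∨ (e₃ 1 = -N ∧ e₃ 0 ≤ 0))
    (h₄ : (e₄ 1 = -N ∧ 0 ≤ e₄ 0) ∨ (e₄ 0 = N ∧ e₄ 1 ≤ 0)) :
    ∃ z ∈ P.support, z ∈ Q.support := by
  have he₁ := hP e₁ (Walk.start_mem_support P)
  have he₃ := hP e₃ (Walk.end_mem_support P)
  have he₂ := hQ e₂ (Walk.start_mem_support Q)
  have he₄ := hQ e₄ (Walk.end_mem_support Q)
  -- the four extensions (lattice walks; those of `Q` are used as `∗`-walks)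
  obtain ⟨r₁, R₁, hr₁, hR₁⟩ := exists_ext₁ (N := N) (e₁ := e₁)
    (h₁.imp id fun h => ⟨h.1, h.2, (he₁ 0).2⟩)
  obtain ⟨r₂, R₂, hr₂, hR₂⟩ := exists_ext₂ (N := N) (e₂ := e₂)
    (h₂.imp id fun h => ⟨h.1, h.2, (he₂ 1).2⟩)
  obtain ⟨r₃, R₃, hr₃, hR₃⟩ := exists_ext₃ (N := N) (e₃ := e₃)
    (h₃.imp id fun h => ⟨h.1, h.2, (he₃ 0).1⟩)
  obtain ⟨r₄, R₄, hr₄, hR₄⟩ := exists_ext₄ (N := N) (e₄ := e₄)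
    (h₄.imp id fun h => ⟨h.1, h.2, (he₄ 1).1⟩)
  set R₂' : zdStarGraph.Walk e₂ r₂ := R₂.mapLe zdGraph_le_zdStarGraph with hR₂'
  set R₄' : zdStarGraph.Walk e₄ r₄ := R₄.mapLe zdGraph_le_zdStarGraph with hR₄'
  -- the extended crossings of `Λ_{N+1}`
  set P' : (zdGraph 2).Walk r₃ r₁ := (R₃.reverse.append P.reverse).append R₁ with hP'
  set Q' : zdStarGraph.Walk r₄ r₂ := (R₄'.reverse.append Q.reverse).append R₂' with hQ'
  have hP'supp : ∀ z ∈ P'.support, z ∈ P.support ∨ (Out₁ N e₁ z ∨ Out₃ N e₃ z) := by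
    intro z hz
    rw [hP', Walk.mem_support_append_iff, Walk.mem_support_append_iff, Walk.support_reverse,
      List.mem_reverse, Walk.support_reverse, List.mem_reverse] at hz
    rcases hz with (hz | hz) | hz
    · rcases hR₃ z hz with rfl | h
      · exact Or.inl (Walk.end_mem_support P)
      · exact Or.inr (Or.inr h)
    · exact Or.inl hz
    · rcases hR₁ z hz with rfl | h
      · exact Or.inl (Walk.start_mem_support P)
      · exact Or.inr (Or.inl h)
  have hQ'supp : ∀ z ∈ Q'.support, z ∈ Q.support ∨ (Out₂ N e₂ z ∨ Out₄ N e₄ z) := by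
    intro z hz
    rw [hQ', Walk.mem_support_append_iff, Walk.mem_support_append_iff, Walk.support_reverse,
      List.mem_reverse, Walk.support_reverse, List.mem_reverse, hR₂', hR₄',
      Walk.support_mapLe_eq_support, Walk.support_mapLe_eq_support] at hz
    rcases hz with (hz | hz) | hz
    · rcases hR₄ z hz with rfl | h
      · exact Or.inl (Walk.end_mem_support Q)
      · exact Or.inr (Or.inr h)
    · exact Or.inl hz
    · rcases hR₂ z hz with rfl | h
      · exact Or.inl (Walk.start_mem_support Q)
      · exact Or.inr (Or.inl h)
  have hbox : ∀ z, (z ∈ P.support ∨ (Out₁ N e₁ z ∨ Out₃ N e₃ z)) ∨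
      (z ∈ Q.support ∨ (Out₂ N e₂ z ∨ Out₄ N e₄ z)) →
      -((N : ℤ) + 1) ≤ z 0 ∧ z 0 ≤ N + 1 ∧ -((N : ℤ) + 1) ≤ z 1 ∧ z 1 ≤ N + 1 := by
    rintro z ((hz | hz) | (hz | hz))
    · have h0 := hP z hz 0; have h1 := hP z hz 1; omega
    · exact bounds_of_out he₁ he₂ he₃ he₄ (Or.inl hz)
    · have h0 := hQ z hz 0; have h1 := hQ z hz 1; omega
    · exact bounds_of_out he₁ he₂ he₃ he₄ (Or.inr hz)
  obtain ⟨z, hzP', hzQ'⟩ := exists_mem_support_of_crossing_star (L := -((N : ℤ) + 1)) (R := N + 1)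
    (B := -((N : ℤ) + 1)) (T := N + 1) P' Q' (fun z hz => hbox z (Or.inl (hP'supp z hz)))
    (fun z hz => hbox z (Or.inr (hQ'supp z hz))) hr₃ hr₁ hr₄ hr₂
  rcases hP'supp z hzP' with hzP | hzodd <;> rcases hQ'supp z hzQ' with hzQ | hzeven
  · exact ⟨z, hzP, hzQ⟩
  · exact absurd hzeven (not_out_of_mem_box (e₁ := e₁) (e₂ := e₂) (e₃ := e₃) (e₄ := e₄) (hP z hzP)).2
  · exact absurd hzodd (not_out_of_mem_box (e₁ := e₁) (e₂ := e₂) (e₃ := e₃) (e₄ := e₄) (hQ z hzQ)).1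
  · rcases eq_of_out_odd_even he₁ he₂ he₃ he₄ hzodd hzeven with (h | h) | (h | h)
    · exact ⟨e₁, Walk.start_mem_support P, h ▸ Walk.start_mem_support Q⟩
    · exact ⟨e₁, Walk.start_mem_support P, h ▸ Walk.end_mem_support Q⟩
    · exact ⟨e₃, Walk.end_mem_support P, h ▸ Walk.start_mem_support Q⟩
    · exact ⟨e₃, Walk.end_mem_support P, h ▸ Walk.end_mem_support Q⟩

/-! ### The reflection `x₀ ↦ -x₀` acts on `∗`-walks -/

/-- The coordinate reflections are automorphisms of the `∗`-graph. [cite: GeorgiiHiguchi2000, §2 p. 3] -/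
def starReflectHom (i : Fin 2) : zdStarGraph →g zdStarGraph where
  toFun := reflectCoord i
  map_rel' := fun {a b} hab => by
    rw [zdStarGraph_adj] at hab ⊢
    refine ⟨fun h => hab.1 ?_, fun j => ?_⟩
    · have := congrArg (reflectCoord i) h
      rwa [reflectCoord_reflectCoord, reflectCoord_reflectCoord] at this
    · have := hab.2 j
      rw [reflectCoord_apply, reflectCoord_apply]
      by_cases hj : j = i
      · simp only [hj, if_true]
        rw [show -a i - -b i = -(a i - b i) by ring, abs_neg]
        subst hj; exact this
      · simp only [hj, if_false]; exact this

/-- `starReflectHom i` acts by `reflectCoord i`. [folklore] -/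
@[simp] theorem starReflectHom_apply (i : Fin 2) (x : Site 2) : starReflectHom i x = reflectCoord i x := rfl

/-- Coordinates of the reflection `x₀ ↦ -x₀`. [folklore] -/
theorem reflectCoord_zero_apply (x : Site 2) :
    reflectCoord 0 x 0 = -x 0 ∧ reflectCoord 0 x 1 = x 1 := by
  simp [reflectCoord_apply]

/-- **Zhang's obstruction, `∗` versus lattice**: inside `Λ_N`, a `∗`-walk from `∂₁Λ_N` to `∂₃Λ_N`
and a lattice walk from `∂₂Λ_N` to `∂₄Λ_N` have a common vertex (from the previous theorem applied
to the images under the reflection `x₀ ↦ -x₀`, which exchanges `∂₁ ↔ ∂₂` and `∂₃ ↔ ∂₄`). [cite: GeorgiiHiguchi2000, Lemma 3.1 (proof, Step 2, p. 8)] -/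
theorem exists_mem_support_of_quadrant_crossing_star' {N : ℕ} {e₁ e₂ e₃ e₄ : Site 2}
    (P : zdStarGraph.Walk e₁ e₃) (Q : (zdGraph 2).Walk e₂ e₄)
    (hP : ∀ z ∈ P.support, ∀ i, -(N : ℤ) ≤ z i ∧ z i ≤ N)
    (hQ : ∀ z ∈ Q.support, ∀ i, -(N : ℤ) ≤ z i ∧ z i ≤ N)
    (h₁ : (e₁ 0 = N ∧ 0 ≤ e₁ 1) ∨ (e₁ 1 = N ∧ 0 ≤ e₁ 0))
    (h₂ : (e₂ 1 = N ∧ e₂ 0 ≤ 0) ∨ (e₂ 0 = -N ∧ 0 ≤ e₂ 1))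
    (h₃ : (e₃ 0 = -N ∧ e₃ 1 ≤ 0) ∨ (e₃ 1 = -N ∧ e₃ 0 ≤ 0))
    (h₄ : (e₄ 1 = -N ∧ 0 ≤ e₄ 0) ∨ (e₄ 0 = N ∧ e₄ 1 ≤ 0)) :
    ∃ z ∈ P.support, z ∈ Q.support := by
  -- reflect: `Q` becomes a lattice walk `∂₁ → ∂₃`, `P` a `∗`-walk `∂₂ → ∂₄`
  have hbd : ∀ z : Site 2, (∀ i, -(N : ℤ) ≤ z i ∧ z i ≤ N) →
      ∀ i, -(N : ℤ) ≤ reflectCoord 0 z i ∧ reflectCoord 0 z i ≤ N := by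
    intro z hz i
    have h0 := hz 0
    rw [reflectCoord_apply]
    by_cases hi : i = 0
    · subst hi; simp; omega
    · simp [hi]; exact hz i
  have hsuppQ : ∀ z, z ∈ (Q.map (reflectCoord (d := 2) 0).toHom).support ↔
      ∃ w ∈ Q.support, reflectCoord 0 w = z := fun z => by
    rw [Walk.support_map, List.mem_map]; rfl
  have hsuppP : ∀ z, z ∈ (P.map (starReflectHom 0)).support ↔
      ∃ w ∈ P.support, reflectCoord 0 w = z := fun z => by
    rw [Walk.support_map, List.mem_map]; rfl
  have hQ'b : ∀ z ∈ (Q.map (reflectCoord (d := 2) 0).toHom).support, ∀ i, -(N : ℤ) ≤ z i ∧ z i ≤ N := by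
    intro z hz
    obtain ⟨w, hw, rfl⟩ := (hsuppQ z).1 hz
    exact hbd w (hQ w hw)
  have hP'b : ∀ z ∈ (P.map (starReflectHom 0)).support, ∀ i, -(N : ℤ) ≤ z i ∧ z i ≤ N := by
    intro z hz
    obtain ⟨w, hw, rfl⟩ := (hsuppP z).1 hz
    exact hbd w (hP w hw)
  have hc : ∀ x : Site 2, reflectCoord 0 x 0 = -x 0 ∧ reflectCoord 0 x 1 = x 1 :=
    fun x => reflectCoord_zero_apply x
  have hc₁ := hc e₁; have hc₂ := hc e₂; have hc₃ := hc e₃; have hc₄ := hc e₄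
  have g₁ : (reflectCoord 0 e₂ 0 = N ∧ 0 ≤ reflectCoord 0 e₂ 1) ∨
      (reflectCoord 0 e₂ 1 = N ∧ 0 ≤ reflectCoord 0 e₂ 0) := by
    rcases h₂ with ⟨h, h'⟩ | ⟨h, h'⟩
    · right; constructor <;> omega
    · left; constructor <;> omega
  have g₂ : (reflectCoord 0 e₁ 1 = N ∧ reflectCoord 0 e₁ 0 ≤ 0) ∨
      (reflectCoord 0 e₁ 0 = -N ∧ 0 ≤ reflectCoord 0 e₁ 1) := by
    rcases h₁ with ⟨h, h'⟩ | ⟨h, h'⟩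
    · right; constructor <;> omega
    · left; constructor <;> omega
  have g₃ : (reflectCoord 0 e₄ 0 = -N ∧ reflectCoord 0 e₄ 1 ≤ 0) ∨
      (reflectCoord 0 e₄ 1 = -N ∧ reflectCoord 0 e₄ 0 ≤ 0) := by
    rcases h₄ with ⟨h, h'⟩ | ⟨h, h'⟩
    · right; constructor <;> omega
    · left; constructor <;> omega
  have g₄ : (reflectCoord 0 e₃ 1 = -N ∧ 0 ≤ reflectCoord 0 e₃ 0) ∨
      (reflectCoord 0 e₃ 0 = N ∧ reflectCoord 0 e₃ 1 ≤ 0) := by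
    rcases h₃ with ⟨h, h'⟩ | ⟨h, h'⟩
    · right; constructor <;> omega
    · left; constructor <;> omega
  obtain ⟨z, hzQ', hzP'⟩ := exists_mem_support_of_quadrant_crossing_star (N := N)
    (Q.map (reflectCoord (d := 2) 0).toHom) (P.map (starReflectHom 0)) hQ'b hP'b g₁ g₂ g₃ g₄
  obtain ⟨w, hwQ, hwz⟩ := (hsuppQ z).1 hzQ'
  obtain ⟨w', hw'P, hw'z⟩ := (hsuppP z).1 hzP'
  have hww' : w' = w := by
    have h1 : reflectCoord 0 w' = reflectCoord 0 w := hw'z.trans hwz.symm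
    have := congrArg (reflectCoord 0) h1
    rwa [reflectCoord_reflectCoord, reflectCoord_reflectCoord] at this
  exact ⟨w, hww' ▸ hw'P, hwQ⟩

end Literature.Probability.LatticeModels
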